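import Summits.Ventures.PercRepro.Night2NearFatReduce

/-!
# night-2: COUNTING THE SUSPECTS — the abstract bounds (gen 40)

The shape lemma of the non-three-planar case (Night2NearFatShape) leaves two kinds of SUSPECT `i`-subsets `Y` of `W`:
those with `≥ i − 1` points on a basis line, and those inside a line through a basis point.  Abstractly:
* **`card_filter_line_ge_le`**: the `i`-subsets of `W` with `≥ i − 1` points on `ℓ ⊆ W` number at most
  `C(|ℓ|, i − 1) · |W ∖ ℓ| + C(|ℓ|, i)` (they are an `(i−1)`-subset of `ℓ` plus one point off `ℓ`, or an `i`-subset of `ℓ`);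
* **`card_filter_subset_or_le`**: the `i`-subsets inside `C₁` or inside `C₂` number at most `C(|C₁|, i) + C(|C₂|, i)`;
* **`card_filter_suspect_le`**: with every basis line inside `ℓ₁` or `ℓ₂` or of `≤ i − 2` points, and every line through a
  basis point inside `C₁` or `C₂` or of `≤ i − 1` points, the suspects number at most the sum of the four terms;
* **`card_filter_good_ge`**: the non-suspect HITTING `i`-subsets number at least
  `C(N, i) − 5 · C(N − 2, i) − (the suspect bound)` (the Bonferroni count of Night2HitCap).
Paper: proofs/NIGHT-2-g40.md §2.
-/

namespace PercRepro.Shadow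

open PercRepro.ThmH PercRepro.PerFlat

variable {α : Type*} [DecidableEq α] {M : Matroid α} [M.Finite] {G : Finset α}

omit [DecidableEq α] in
/-- **The `i`-subsets with `≥ i − 1` points on a line `ℓ`**: at most `C(|ℓ|, i − 1) · |W ∖ ℓ| + C(|ℓ|, i)`. -/
theorem card_filter_line_ge_le [DecidableEq α] (W ℓ : Finset α) (i : ℕ) (hi : 1 ≤ i) :
    ((W.powersetCard i).filter (fun Y => i - 1 ≤ (Y ∩ ℓ).card)).card ≤
      ℓ.card.choose (i - 1) * (W \ ℓ).card + ℓ.card.choose i := by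
  have hsub : (W.powersetCard i).filter (fun Y => i - 1 ≤ (Y ∩ ℓ).card) ⊆
      ((ℓ.powersetCard (i - 1)) ×ˢ (W \ ℓ)).image (fun p => insert p.2 p.1) ∪ ℓ.powersetCard i := by
    intro Y hY
    rw [Finset.mem_filter, Finset.mem_powersetCard] at hY
    obtain ⟨⟨hYW, hYi⟩, hYℓ⟩ := hY
    have hsplit := Finset.card_sdiff_add_card_inter Y ℓ
    rw [Finset.mem_union]
    rcases Nat.lt_or_ge (Y ∩ ℓ).card i with hlt | hge
    · -- exactly `i − 1` points on `ℓ`: one point off `ℓ`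
      have h1 : (Y \ ℓ).card = 1 := by omega
      obtain ⟨x, hx⟩ := Finset.card_eq_one.1 h1
      left
      rw [Finset.mem_image]
      refine ⟨(Y ∩ ℓ, x), ?_, ?_⟩
      · rw [Finset.mem_product, Finset.mem_powersetCard]
        have hxY : x ∈ Y \ ℓ := hx ▸ Finset.mem_singleton_self x
        rw [Finset.mem_sdiff] at hxY
        refine ⟨⟨Finset.inter_subset_right, ?_⟩, Finset.mem_sdiff.2 ⟨hYW hxY.1, hxY.2⟩⟩
        show (Y ∩ ℓ).card = i - 1
        omega
      · ext v
        simp only [Finset.mem_insert, Finset.mem_inter]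
        constructor
        · rintro (rfl | ⟨hv, -⟩)
          · exact (Finset.mem_sdiff.1 (hx ▸ Finset.mem_singleton_self v : v ∈ Y \ ℓ)).1
          · exact hv
        · intro hv
          by_cases hvℓ : v ∈ ℓ
          · exact Or.inr ⟨hv, hvℓ⟩
          · left
            have : v ∈ Y \ ℓ := Finset.mem_sdiff.2 ⟨hv, hvℓ⟩
            rw [hx, Finset.mem_singleton] at this
            exact this
    · -- all of `Y` on `ℓ`
      right
      rw [Finset.mem_powersetCard]
      refine ⟨?_, hYi⟩
      have h0 : (Y \ ℓ).card = 0 := by omega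
      rw [Finset.card_eq_zero, Finset.sdiff_eq_empty_iff_subset] at h0
      exact h0
  refine le_trans (Finset.card_le_card hsub) ?_
  refine le_trans (Finset.card_union_le _ _) ?_
  refine Nat.add_le_add ?_ ?_
  · refine le_trans Finset.card_image_le ?_
    rw [Finset.card_product, Finset.card_powersetCard]
  · rw [Finset.card_powersetCard]

omit [DecidableEq α] in
/-- **The `i`-subsets inside `C₁` or inside `C₂`**: at most `C(|C₁|, i) + C(|C₂|, i)`. -/
theorem card_filter_subset_or_le [DecidableEq α] (W C₁ C₂ : Finset α) (i : ℕ) :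
    ((W.powersetCard i).filter (fun Y => Y ⊆ C₁ ∨ Y ⊆ C₂)).card ≤ C₁.card.choose i + C₂.card.choose i := by
  have hsub : (W.powersetCard i).filter (fun Y => Y ⊆ C₁ ∨ Y ⊆ C₂) ⊆ C₁.powersetCard i ∪ C₂.powersetCard i := by
    intro Y hY
    rw [Finset.mem_filter, Finset.mem_powersetCard] at hY
    rw [Finset.mem_union, Finset.mem_powersetCard, Finset.mem_powersetCard]
    rcases hY.2 with h | h
    · exact Or.inl ⟨h, hY.1.2⟩
    · exact Or.inr ⟨h, hY.1.2⟩
  refine le_trans (Finset.card_le_card hsub) ?_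
  refine le_trans (Finset.card_union_le _ _) ?_
  rw [Finset.card_powersetCard, Finset.card_powersetCard]

omit [DecidableEq α] in
/-- **The suspects**, abstractly: with every "basis line" `ℓ ∈ 𝓑` inside `ℓ₁` or `ℓ₂` or of `≤ i − 2` points and every
"class" `C ∈ 𝓒` inside `C₁` or `C₂` or of `≤ i − 1` points, the `i`-subsets of `W` with `≥ i − 1` points on some `ℓ ∈ 𝓑`
or inside some `C ∈ 𝓒` number at most `h(ℓ₁) + h(ℓ₂) + C(|C₁|, i) + C(|C₂|, i)`, `h(ℓ) = C(|ℓ|, i−1) |W ∖ ℓ| + C(|ℓ|, i)`. -/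
theorem card_filter_suspect_le [DecidableEq α] (W ℓ₁ ℓ₂ C₁ C₂ : Finset α)
    (𝓑 𝓒 : Finset (Finset α)) (i : ℕ) (hi : 1 ≤ i)
    (h𝓑 : ∀ ℓ ∈ 𝓑, ℓ ⊆ ℓ₁ ∨ ℓ ⊆ ℓ₂ ∨ ℓ.card + 2 ≤ i)
    (h𝓒 : ∀ C ∈ 𝓒, C ⊆ C₁ ∨ C ⊆ C₂ ∨ C.card + 1 ≤ i) :
    ((W.powersetCard i).filter (fun Y => (∃ ℓ ∈ 𝓑, i - 1 ≤ (Y ∩ ℓ).card) ∨ ∃ C ∈ 𝓒, Y ⊆ C)).card ≤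
      (ℓ₁.card.choose (i - 1) * (W \ ℓ₁).card + ℓ₁.card.choose i) +
        (ℓ₂.card.choose (i - 1) * (W \ ℓ₂).card + ℓ₂.card.choose i) +
        (C₁.card.choose i + C₂.card.choose i) := by
  have hsub : (W.powersetCard i).filter (fun Y => (∃ ℓ ∈ 𝓑, i - 1 ≤ (Y ∩ ℓ).card) ∨ ∃ C ∈ 𝓒, Y ⊆ C) ⊆
      ((W.powersetCard i).filter (fun Y => i - 1 ≤ (Y ∩ ℓ₁).card) ∪
        (W.powersetCard i).filter (fun Y => i - 1 ≤ (Y ∩ ℓ₂).card)) ∪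
        (W.powersetCard i).filter (fun Y => Y ⊆ C₁ ∨ Y ⊆ C₂) := by
    intro Y hY
    rw [Finset.mem_filter] at hY
    obtain ⟨hYW, hcase⟩ := hY
    have hYi : Y.card = i := (Finset.mem_powersetCard.1 hYW).2
    rw [Finset.mem_union, Finset.mem_union, Finset.mem_filter, Finset.mem_filter, Finset.mem_filter]
    rcases hcase with ⟨ℓ, hℓ, hYℓ⟩ | ⟨C, hC, hYC⟩
    · rcases h𝓑 ℓ hℓ with h | h | h
      · exact Or.inl (Or.inl ⟨hYW, le_trans hYℓ (Finset.card_le_card (Finset.inter_subset_inter (Finset.Subset.refl Y) h))⟩)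
      · exact Or.inl (Or.inr ⟨hYW, le_trans hYℓ (Finset.card_le_card (Finset.inter_subset_inter (Finset.Subset.refl Y) h))⟩)
      · exfalso
        have := Finset.card_le_card (Finset.inter_subset_right (s₁ := Y) (s₂ := ℓ))
        omega
    · rcases h𝓒 C hC with h | h | h
      · exact Or.inr ⟨hYW, Or.inl (hYC.trans h)⟩
      · exact Or.inr ⟨hYW, Or.inr (hYC.trans h)⟩
      · exfalso
        have := Finset.card_le_card hYC
        omega
  refine le_trans (Finset.card_le_card hsub) ?_
  refine le_trans (Finset.card_union_le _ _) ?_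
  refine Nat.add_le_add (le_trans (Finset.card_union_le _ _) (Nat.add_le_add ?_ ?_)) ?_
  · exact card_filter_line_ge_le W ℓ₁ i hi
  · exact card_filter_line_ge_le W ℓ₂ i hi
  · exact card_filter_subset_or_le W C₁ C₂ i

omit [DecidableEq α] in
/-- **The good `i`-subsets**: `|W| choose i` minus the bad ones (contained in some `D w`, `w ∈ A`, each meeting `W` in
`≤ |W| − 2` points) minus the suspects — the abstract lower bound feeding the income. -/
theorem card_filter_good_ge [DecidableEq α] {β : Type*} (W : Finset α) (A : Finset β) (D : β → Finset α)
    (hD : ∀ w ∈ A, (D w ∩ W).card + 2 ≤ W.card) (S : Finset α → Prop) [DecidablePred S] (i : ℕ) :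
    ((W.card.choose i : ℕ) : ℚ) - (A.card : ℚ) * (((W.card - 2).choose i : ℕ) : ℚ) -
        (((W.powersetCard i).filter S).card : ℚ) ≤
      (((W.powersetCard i).filter (fun Y => ¬ S Y ∧ ∀ w ∈ A, ¬ Y ⊆ D w)).card : ℚ) := by
  have h1 := card_filter_forall_not_subset_ge W A D hD i
  have hsplit := Finset.card_filter_add_card_filter_not (s := (W.powersetCard i).filter (fun Y => ∀ w ∈ A, ¬ Y ⊆ D w))
    (fun Y => S Y)
  rw [Finset.filter_filter, Finset.filter_filter] at hsplit
  have hle : ((W.powersetCard i).filter (fun Y => (∀ w ∈ A, ¬ Y ⊆ D w) ∧ S Y)).card ≤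
      ((W.powersetCard i).filter S).card := by
    apply Finset.card_le_card
    intro Y hY
    rw [Finset.mem_filter] at hY ⊢
    exact ⟨hY.1, hY.2.2⟩
  have heq : (W.powersetCard i).filter (fun Y => (∀ w ∈ A, ¬ Y ⊆ D w) ∧ ¬ S Y) =
      (W.powersetCard i).filter (fun Y => ¬ S Y ∧ ∀ w ∈ A, ¬ Y ⊆ D w) := by
    apply Finset.filter_congr
    intro Y _
    tauto
  rw [heq] at hsplit
  have h2 : ((((W.powersetCard i).filter (fun Y => (∀ w ∈ A, ¬ Y ⊆ D w) ∧ S Y)).card : ℕ) : ℚ) +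
      ((((W.powersetCard i).filter (fun Y => ¬ S Y ∧ ∀ w ∈ A, ¬ Y ⊆ D w)).card : ℕ) : ℚ) =
      ((((W.powersetCard i).filter (fun Y => ∀ w ∈ A, ¬ Y ⊆ D w)).card : ℕ) : ℚ) := by exact_mod_cast hsplit
  have h3 : ((((W.powersetCard i).filter (fun Y => (∀ w ∈ A, ¬ Y ⊆ D w) ∧ S Y)).card : ℕ) : ℚ) ≤
      ((((W.powersetCard i).filter S).card : ℕ) : ℚ) := by exact_mod_cast hle
  linarith

end PercRepro.Shadow
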